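import Mathlib.Analysis.InnerProductSpace.PiL2
import Literature.Analysis.Calculus.RadialCalculus
import HarnessLib

/-!
# Tangent frames at a point and the transfer of tangential traces

Analysis support file (everything proved; no definitions, no named facts) for the cylindrical
coordinates of A. Waldron, *Long-time existence for Yang–Mills flow*, Invent. math. 217 (2019),
§4, done extrinsically: the pointwise norms of tangential tensors on the sphere through `x ≠ 0`
(`|Ω|²_θ`, `|∇^θΩ|²`, `|d_θ^*Ω|²`, …) are written as sums over an ambient orthonormal frame `b`
with the tangential projection `P_x` inserted; to estimate them (e.g. the Kato-type inequality
`|d_θ^*Ω|² ≤ 2|∇^θΩ|²`, which counts tangential directions) one transfers such sums to an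
orthonormal frame `e` of the tangent space `K = x^⊥ = (ℝ ∙ x)ᗮ` (Mathlib's
`OrthonormalBasis.fromOrthogonalSpanSingleton`):

* `tangentialProj_apply_of_mem_orthogonal`, `tangentialProj_apply_mem_orthogonal` — `P` is the
  identity on `K` and maps into `K`;
* `sum_inner_tangentialProj_mul_inner_tangentialProj` —
  `∑ₖ ⟨u, P bₖ⟩⟨w, P bₖ⟩ = ⟨u, w⟩` for `u, w ∈ K`;
* `sum_bilinear_tangentialProj_eq_sum_frame` — **transfer of tangential traces**: for every
  continuous bilinear `B`, `∑ₖ B(P bₖ, P bₖ) = ∑ₐ B(eₐ, eₐ)` for any orthonormal basis `e` of `K`;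
* `sum_norm_sum_diag_sq_le` — the Kato-type count in a 3-frame: `∑_c‖∑ₐ T a a c‖² ≤ ∑‖T a b c‖²`
  for `T` antisymmetric in its last two slots (`|d_θ^*Ω|² ≤ 2|∇^θΩ|²` on `S³`).

References: A. Waldron, Invent. math. 217 (2019), §4.2 [Waldron2019]; (linear algebra) [folklore].
-/

noncomputable section

open scoped RealInnerProductSpace
open Module Submodule

namespace Literature.Analysis.Calculus

variable {E : Type*} [NormedAddCommGroup E] [InnerProductSpace ℝ E]

/-- `P_x` is the identity on the tangent space `K = (ℝ ∙ x)ᗮ`. [folklore] -/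
theorem tangentialProj_apply_of_mem_orthogonal {x u : E} (hu : u ∈ (ℝ ∙ x)ᗮ) :
    tangentialProj x u = u :=
  tangentialProj_eq_self (mem_orthogonal_singleton_iff_inner_right.1 hu)

/-- `P_x` maps into the tangent space `K = (ℝ ∙ x)ᗮ`. [folklore] -/
theorem tangentialProj_apply_mem_orthogonal (x v : E) : tangentialProj x v ∈ (ℝ ∙ x)ᗮ := by
  rw [mem_orthogonal_singleton_iff_inner_left]
  exact inner_tangentialProj_left_self x v

/-- For tangential `u` and any `v`: `⟨u, P v⟩ = ⟨u, v⟩`. [folklore] -/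
theorem inner_tangentialProj_right_of_mem_orthogonal {x u : E} (hu : u ∈ (ℝ ∙ x)ᗮ) (v : E) :
    ⟪u, tangentialProj x v⟫ = ⟪u, v⟫ := by
  rw [← inner_tangentialProj_comm, tangentialProj_apply_of_mem_orthogonal hu]

variable {ι : Type*} [Fintype ι]

/-- `∑ₖ ⟨u, P bₖ⟩⟨w, P bₖ⟩ = ⟨u, w⟩` for `u, w` tangential and `b` an orthonormal basis of `E`.
[folklore] -/
theorem sum_inner_tangentialProj_mul_inner_tangentialProj (b : OrthonormalBasis ι ℝ E) {x u w : E}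
    (hu : u ∈ (ℝ ∙ x)ᗮ) (hw : w ∈ (ℝ ∙ x)ᗮ) :
    ∑ k, ⟪u, tangentialProj x (b k)⟫ * ⟪w, tangentialProj x (b k)⟫ = ⟪u, w⟫ := by
  simp_rw [inner_tangentialProj_right_of_mem_orthogonal hu, inner_tangentialProj_right_of_mem_orthogonal hw]
  rw [← b.sum_inner_mul_inner u w]
  exact Finset.sum_congr rfl fun k _ => by rw [real_inner_comm (b k) w]

/-- Expansion of a tangential vector in an orthonormal frame of the tangent space. [folklore] -/
theorem sum_inner_smul_frame_eq {κ : Type*} [Fintype κ] {x : E} (e : OrthonormalBasis κ ℝ (ℝ ∙ x)ᗮ)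
    {w : E} (hw : w ∈ (ℝ ∙ x)ᗮ) : ∑ a, ⟪(e a : E), w⟫ • (e a : E) = w := by
  have h := e.sum_repr' ⟨w, hw⟩
  have h' := congrArg (fun z : (ℝ ∙ x)ᗮ => (z : E)) h
  simpa [Submodule.coe_sum, Submodule.coe_smul, Submodule.coe_inner] using h'

/-- **Transfer of tangential traces.** For a continuous bilinear map `B`, an orthonormal basis `b`
of `E` and an orthonormal basis `e` of the tangent space `K = (ℝ ∙ x)ᗮ`:
`∑ₖ B(P_x bₖ, P_x bₖ) = ∑ₐ B(eₐ, eₐ)`. [folklore] -/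
theorem sum_bilinear_tangentialProj_eq_sum_frame {κ : Type*} [Fintype κ] [DecidableEq κ] {F : Type*}
    [NormedAddCommGroup F] [NormedSpace ℝ F] (b : OrthonormalBasis ι ℝ E) {x : E}
    (e : OrthonormalBasis κ ℝ (ℝ ∙ x)ᗮ) (B : E →L[ℝ] E →L[ℝ] F) :
    ∑ k, B (tangentialProj x (b k)) (tangentialProj x (b k)) = ∑ a, B (e a : E) (e a : E) := by
  -- expand `P bₖ` in the frame `e`
  have hexp : ∀ k, tangentialProj x (b k) =
      ∑ a, ⟪(e a : E), tangentialProj x (b k)⟫ • (e a : E) := fun k =>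
    (sum_inner_smul_frame_eq e (tangentialProj_apply_mem_orthogonal x (b k))).symm
  have hstep : ∀ k, B (tangentialProj x (b k)) (tangentialProj x (b k)) =
      ∑ a, ∑ c, (⟪(e a : E), tangentialProj x (b k)⟫ * ⟪(e c : E), tangentialProj x (b k)⟫) •
        B (e c : E) (e a : E) := by
    intro k
    conv_lhs => rw [hexp k]
    simp only [map_sum, map_smul, FunLike.coe_sum, Finset.sum_apply, FunLike.coe_smul,
      Pi.smul_apply]
    refine Finset.sum_congr rfl fun a _ => ?_
    rw [Finset.smul_sum]
    refine Finset.sum_congr rfl fun c _ => ?_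
    rw [smul_smul]
  -- orthonormality of `e` in `K`
  have horth : ∀ a c, ∑ k, ⟪(e a : E), tangentialProj x (b k)⟫ * ⟪(e c : E), tangentialProj x (b k)⟫ =
      if a = c then (1 : ℝ) else 0 := by
    intro a c
    rw [sum_inner_tangentialProj_mul_inner_tangentialProj b (e a).2 (e c).2,
      ← Submodule.coe_inner, e.inner_eq_ite]
  simp_rw [hstep]
  rw [Finset.sum_comm]
  refine Finset.sum_congr rfl fun a _ => ?_
  rw [Finset.sum_comm]
  simp_rw [← Finset.sum_smul, horth]
  simp

/-! ### The Kato-type inequality `|d^*Ω|² ≤ 2|∇Ω|²` in a tangent 3-frame -/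

/-- `‖p + q‖² ≤ 2‖p‖² + 2‖q‖²` in a real inner product space. [folklore] -/
theorem norm_add_sq_le_two_mul {W : Type*} [NormedAddCommGroup W] [InnerProductSpace ℝ W]
    (p q : W) : ‖p + q‖ ^ 2 ≤ 2 * ‖p‖ ^ 2 + 2 * ‖q‖ ^ 2 := by
  have h := parallelogram_law_with_norm ℝ p q
  nlinarith [h, sq_nonneg ‖p - q‖, mul_self_nonneg ‖p + q‖, mul_self_nonneg ‖p‖, mul_self_nonneg ‖q‖]

/-- **The Kato-type inequality for the codifferential of a 2-form in three tangential directions.**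
For a family `T a b c` (the components `(∇_{e_a}Ω)(e_b, e_c)` of the covariant derivative of a
2-form in an orthonormal 3-frame), antisymmetric in `(b, c)`:
`∑_c ‖∑ₐ T a a c‖² ≤ ∑ₐ∑_b∑_c ‖T a b c‖²`, i.e. `|d^*Ω|² ≤ 2|∇Ω|²` with
`|∇Ω|² = ½∑‖T a b c‖²` (each component of `d^*Ω` is a sum of two off-diagonal components, and
`‖p+q‖² ≤ 2‖p‖² + 2‖q‖²`). [folklore] -/
theorem sum_norm_sum_diag_sq_le {W : Type*} [NormedAddCommGroup W] [InnerProductSpace ℝ W]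
    (T : Fin 3 → Fin 3 → Fin 3 → W) (hT : ∀ a b c, T a b c = -T a c b) :
    ∑ c, ‖∑ a, T a a c‖ ^ 2 ≤ ∑ a, ∑ b, ∑ c, ‖T a b c‖ ^ 2 := by
  have hdiag : ∀ a b, T a b b = 0 := fun a b => by
    have h := hT a b b
    have : (2 : ℝ) • T a b b = 0 := by rw [two_smul]; nth_rewrite 2 [h]; exact add_neg_cancel _
    exact (smul_eq_zero.1 this).resolve_left two_ne_zero
  have hnorm : ∀ a b c, ‖T a c b‖ = ‖T a b c‖ := fun a b c => by rw [hT a c b, norm_neg]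
  simp only [Fin.sum_univ_three, hdiag, zero_add, add_zero]
  have h0 := norm_add_sq_le_two_mul (T 1 1 0) (T 2 2 0)
  have h1 := norm_add_sq_le_two_mul (T 0 0 1) (T 2 2 1)
  have h2 := norm_add_sq_le_two_mul (T 0 0 2) (T 1 1 2)
  rw [hnorm 0 0 1, hnorm 0 0 2, hnorm 1 1 0, hnorm 1 1 2, hnorm 2 2 0, hnorm 2 2 1]
  simp only [norm_zero, zero_pow two_ne_zero, zero_add, add_zero]
  linarith [h0, h1, h2, sq_nonneg ‖T 0 1 2‖, sq_nonneg ‖T 0 2 1‖, sq_nonneg ‖T 1 0 2‖,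
    sq_nonneg ‖T 1 2 0‖, sq_nonneg ‖T 2 0 1‖, sq_nonneg ‖T 2 1 0‖]

end Literature.Analysis.Calculus
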